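import Literature.MathematicalPhysics.QuantumFieldTheory.QCDTransferMatrix
import Literature.MathematicalPhysics.QuantumLattice.CPeriodicBoundaryConditions
import Literature.MathematicalPhysics.QuantumFieldTheory.Sweep1ShenZhuZhuProofs
import HarnessLib

/-!
# The gauge data of one time slice of lattice QCD are charge-conjugation invariant
(stub `stub_sliceData_suConj` of line `twisted_trace_transfer` for crux
`QuarksAsStableAction.StableActionBridge`, item stmt-QuantumFields-9737, `--supports`; sub-goal Q2c)

To prove that the vacuum of Lüscher's transfer matrix of lattice QCD is fermion-even, the line
`twisted_trace_transfer` uses charge conjugation: particle–hole conjugation on the slice Fock space combined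
with complex conjugation `U ↦ Ū` (`suConj 3`, the `σ` of C-periodic boundary conditions) of all link
variables.  This file records that the GAUGE data of one time slice (`Literature/…/QCDTransferMatrix.lean`)
are invariant under `U ↦ Ū`:

1. the pure-gauge transfer kernel `K_β = gaugeSliceKernel β`: `Re tr(Ū V̄ᴴ) = Re tr(U Vᴴ)` (the matrix
   `Ū V̄ᴴ` is the entrywise conjugate of `U Vᴴ`, so its trace is conjugated and the real part is unchanged)
   and `S₃(Ū) = S₃(U)` for the Wilson action of the spatial torus in the fundamental representation (the
   plaquette holonomy of `Ū` is `suConj` of the plaquette holonomy, `suConj` being a group homomorphism,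
   and again only the trace gets conjugated);
2. the gauge action: `(Ū)^{ḡ} = (U^g)‾` pointwise, since `suConj 3` is a group homomorphism;
3. the Fock gauge rotation: `Γ(G_{ḡ}) = Γ(G_g)‾` entrywise — the one-particle colour rotation of `ḡ` is the
   entrywise conjugate of that of `g` (its entries are entries of `g(x)`, `0` or `1`), `Matrix.reindex`
   commutes with entrywise maps, and the matrix of minors of a conjugated matrix is the conjugated matrix
   of minors (`RingHom.map_det`);
4. the Haar measures on the spatial links (`sliceHaar`) and on the temporal links (`g : sites → SU(3)`):
   `suConj N` is a continuous automorphism (an involution, `suConj_suConj`) of the compact group `SU(N)`,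
   hence pushes the Haar probability measure to a left-invariant probability measure, which is the Haar
   probability measure again (`map_haarProbability_of_mulEquiv`, uniqueness of Haar measure); the product
   statements follow factorwise (`measurePreserving_pi`).

Pure theorem file (no definitions); helpers in the sub-namespace `StubSliceDataSuConj`.

[cite: Smit2023, §4.6 (4.121)–(4.129)] [cite: LuciniEtAl2016, §6]
-/

noncomputable section

open MeasureTheory
open scoped Matrix BigOperators ComplexConjugate
open Literature.MathematicalPhysics.QuantumFieldTheory Literature.MathematicalPhysics.QuantumLattice
open Literature.Probability.LatticeModels (TorusSite)

namespace Summit.QuantumFields.QCD.Cruxes.StableActionBridge.TwistedTraceTransfer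

namespace StubSliceDataSuConj

variable {Nf S : ℕ}

/-! ### Traces and minors of entrywise-conjugated matrices -/

/-- `Re tr(M̄ N̄ᴴ) = Re tr(M Nᴴ)`: `M̄ N̄ᴴ = (M Nᴴ)‾` entrywise, the trace is conjugated, the real part is
unchanged. [folklore] -/
theorem re_trace_conj_mul_conjTranspose_conj {n : Type*} [Fintype n] (M N : Matrix n n ℂ) :
    (M.map (starRingEnd ℂ) * (N.map (starRingEnd ℂ))ᴴ).trace.re = (M * Nᴴ).trace.re := by
  have h : M.map (starRingEnd ℂ) * (N.map (starRingEnd ℂ))ᴴ = (M * Nᴴ).map (starRingEnd ℂ) := by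
    rw [← Matrix.conjTranspose_map (starRingEnd ℂ) (fun x => by simp), ← Matrix.map_mul]
  rw [h, ← AddMonoidHom.map_trace, Complex.conj_re]

/-- The matrix of minors of an entrywise-conjugated matrix is the entrywise conjugate of the matrix of
minors: `Γ(X̄) = Γ(X)‾` for the Fock functor `fockLift` (`det` commutes with ring homomorphisms).
[folklore] -/
theorem fockLift_map_conj {ι : Type*} [LinearOrder ι] (X : Matrix ι ι ℂ) :
    fockLift (X.map (starRingEnd ℂ)) = (fockLift X).map (starRingEnd ℂ) := by
  ext s t
  simp only [fockLift, Matrix.map_apply, Matrix.of_apply]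
  split_ifs with h
  · rw [Matrix.submatrix_map, RingHom.map_det, RingHom.mapMatrix_apply]
  · rw [map_zero]

/-! ### The Wilson gauge kernel -/

/-- The plaquette holonomies of `Ū` are the conjugates of those of `U` (`suConj N` is a group
homomorphism). [folklore] -/
theorem plaquetteHolonomy_suConj {d L N : ℕ}
    (U : GaugeConfig d L (Matrix.specialUnitaryGroup (Fin N) ℂ))
    (x : Literature.MathematicalPhysics.QuantumFieldTheory.Site d L) (i j : Fin d) :
    plaquetteHolonomy (fun e => suConj N (U e)) x i j = suConj N (plaquetteHolonomy U x i j) := by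
  simp [plaquetteHolonomy, map_mul, map_inv]

/-- **`S(Ū) = S(U)`**: the Wilson action in the fundamental representation is invariant under charge
conjugation of all links (each plaquette trace is conjugated, its real part is unchanged).
[cite: LuciniEtAl2016, §6] -/
theorem wilsonAction_suConj {d L N : ℕ} [NeZero L]
    (U : GaugeConfig d L (Matrix.specialUnitaryGroup (Fin N) ℂ)) :
    wilsonAction (fundamentalRep (Fin N)) (fun e => suConj N (U e)) = wilsonAction (fundamentalRep (Fin N)) U := by
  unfold wilsonAction
  refine Finset.sum_congr rfl fun p _ => ?_
  rw [plaquetteHolonomy_suConj, fundamentalRep_apply, fundamentalRep_apply, coe_suConj,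
    ← AddMonoidHom.map_trace, Complex.conj_re]

/-- **The pure-gauge transfer kernel is charge-conjugation invariant**: `K_β(Ū, Ū') = K_β(U, U')`
(`S₃(Ū) = S₃(U)` for the two half-actions and `Re tr(Ū_l Ū'_lᴴ) = Re tr(U_l U'_lᴴ)` for the temporal
plaquettes). [cite: Smit2023, §4.6 (4.121)–(4.129)] -/
theorem gaugeSliceKernel_suConj [NeZero S] (β : ℝ)
    (U U' : GaugeConfig 3 S (Matrix.specialUnitaryGroup (Fin 3) ℂ)) :
    gaugeSliceKernel β (fun e => suConj 3 (U e)) (fun e => suConj 3 (U' e)) = gaugeSliceKernel β U U' := by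
  unfold gaugeSliceKernel
  simp only [wilsonAction_suConj, coe_suConj, re_trace_conj_mul_conjTranspose_conj]

/-! ### The gauge action and the Fock gauge rotation -/

/-- **`(Ū)^{ḡ} = (U^g)‾`**: gauge transformations commute with charge conjugation of links and gauge
functions (`suConj 3` is a group homomorphism). [cite: LuciniEtAl2016, §6] -/
theorem gaugeTransform_suConj {d L N : ℕ}
    (g : Literature.MathematicalPhysics.QuantumFieldTheory.Site d L → Matrix.specialUnitaryGroup (Fin N) ℂ)
    (U : GaugeConfig d L (Matrix.specialUnitaryGroup (Fin N) ℂ)) :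
    gaugeTransform (fun x => suConj N (g x)) (fun e => suConj N (U e)) =
      fun e => suConj N (gaugeTransform g U e) := by
  funext e
  simp [gaugeTransform, map_mul, map_inv]

/-- The one-particle colour rotation of `ḡ` is the entrywise conjugate of that of `g` (its entries are
entries of `g(x)`, or `0`, times entries of the identity spin matrix). [cite: Smit2023, §4.6 (4.124)–(4.126)] -/
theorem sliceGaugeRot_suConj [NeZero S] (g : TorusSite 3 S → Matrix.specialUnitaryGroup (Fin 3) ℂ) :
    sliceGaugeRot (Nf := Nf) (fun x => suConj 3 (g x)) = (sliceGaugeRot (Nf := Nf) g).map (starRingEnd ℂ) := by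
  ext p q
  simp only [sliceGaugeRot, sliceKron, Matrix.map_apply, Matrix.of_apply, coe_suConj, map_mul,
    apply_ite (starRingEnd ℂ), map_zero, Matrix.one_apply, map_one]

/-- **`Γ(G_{ḡ}) = Γ(G_g)‾` entrywise**: the Fock gauge rotation of the conjugated gauge function is the
entrywise conjugate (conjugated one-particle rotation, `reindex` commutes with entrywise maps, conjugated
minors). [cite: Smit2023, §4.6 (4.125)–(4.127)] -/
theorem fockGaugeAct_suConj [NeZero S] (g : TorusSite 3 S → Matrix.specialUnitaryGroup (Fin 3) ℂ) :
    fockGaugeAct (Nf := Nf) (fun x => suConj 3 (g x)) = (fockGaugeAct (Nf := Nf) g).map (starRingEnd ℂ) := by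
  unfold fockGaugeAct
  rw [sliceGaugeRot_suConj, Matrix.reindex_apply, Matrix.reindex_apply, Matrix.submatrix_map,
    fockLift_map_conj]

/-! ### Haar measure -/

/-- Charge conjugation `suConj N : SU(N) → SU(N)` is continuous (entrywise complex conjugation).
[folklore] -/
theorem continuous_suConj (N : ℕ) : Continuous (suConj N) :=
  Continuous.subtype_mk (continuous_subtype_val.matrix_map Complex.continuous_conj) _

/-- `suConj N ∘ suConj N = id` as monoid homomorphisms (charge conjugation is an involution). [folklore] -/
theorem suConj_comp_suConj (N : ℕ) : (suConj N).comp (suConj N) = MonoidHom.id _ :=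
  MonoidHom.ext (suConj_suConj N)

/-- **Charge conjugation preserves the Haar probability measure of `SU(N)`**: `suConj N` is a continuous
automorphism of the compact group `SU(N)`, so the push-forward of the Haar probability measure is a
left-invariant probability measure, i.e. the Haar probability measure (uniqueness). [folklore] -/
theorem measurePreserving_suConj (N : ℕ) :
    MeasurePreserving (suConj N) (haarProbability (Matrix.specialUnitaryGroup (Fin N) ℂ))
      (haarProbability (Matrix.specialUnitaryGroup (Fin N) ℂ)) := by
  refine ⟨(continuous_suConj N).measurable, ?_⟩
  have h := map_haarProbability_of_mulEquiv
    ((suConj N).toMulEquiv (suConj N) (suConj_comp_suConj N) (suConj_comp_suConj N))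
    (by simpa only [MonoidHom.toMulEquiv_apply] using continuous_suConj N)
  simpa only [MonoidHom.toMulEquiv_apply] using h

/-- Charge conjugation of all links preserves the product Haar measure on any finite family of links.
[folklore] -/
theorem measurePreserving_pi_suConj (ι : Type*) [Fintype ι] (N : ℕ) :
    MeasurePreserving (fun U : ι → Matrix.specialUnitaryGroup (Fin N) ℂ => fun i => suConj N (U i))
      (Measure.pi fun _ => haarProbability (Matrix.specialUnitaryGroup (Fin N) ℂ))
      (Measure.pi fun _ => haarProbability (Matrix.specialUnitaryGroup (Fin N) ℂ)) :=
  measurePreserving_pi (fun _ : ι => haarProbability (Matrix.specialUnitaryGroup (Fin N) ℂ))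
    (fun _ : ι => haarProbability (Matrix.specialUnitaryGroup (Fin N) ℂ)) fun _ => measurePreserving_suConj N

/-- Charge conjugation of the spatial links preserves `sliceHaar`. [folklore] -/
theorem measurePreserving_sliceHaar_suConj [NeZero S] :
    MeasurePreserving (fun U : GaugeConfig 3 S (Matrix.specialUnitaryGroup (Fin 3) ℂ) => fun e => suConj 3 (U e))
      (sliceHaar S) (sliceHaar S) :=
  measurePreserving_pi_suConj (Edge 3 S) 3

end StubSliceDataSuConj

/-- **Sub-goal Q2c (registered stub `stub_sliceData_suConj`): the slice data are charge-conjugation invariant** — the Wilson gauge kernel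
(`Re tr(Ū V̄ᴴ) = Re tr(U Vᴴ)`, `S₃(Ū) = S₃(U)`), the gauge action (`(U^g)‾ = Ū^{ḡ}`), the Fock gauge rotation (`Γ(G_{ḡ}) = Γ(G_g)‾`
entrywise) and the Haar measures on the spatial links and on the temporal links (`suConj` is a continuous automorphism of the compact
group, so it preserves the Haar probability measure). [folklore] -/
theorem stub_sliceData_suConj : ∀ (Nf S : ℕ) [NeZero S] (β : ℝ),
    (∀ U U' : GaugeConfig 3 S (Matrix.specialUnitaryGroup (Fin 3) ℂ),
      gaugeSliceKernel β (fun e => suConj 3 (U e)) (fun e => suConj 3 (U' e)) = gaugeSliceKernel β U U') ∧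
    (∀ (g : TorusSite 3 S → (Matrix.specialUnitaryGroup (Fin 3) ℂ)) (U : GaugeConfig 3 S (Matrix.specialUnitaryGroup (Fin 3) ℂ)),
      gaugeTransform (fun x => suConj 3 (g x)) (fun e => suConj 3 (U e)) = fun e => suConj 3 (gaugeTransform g U e)) ∧
    (∀ g : TorusSite 3 S → (Matrix.specialUnitaryGroup (Fin 3) ℂ),
      @fockGaugeAct Nf S _ (fun x => suConj 3 (g x)) = (@fockGaugeAct Nf S _ g).map (starRingEnd ℂ)) ∧
    MeasurePreserving (fun U : GaugeConfig 3 S (Matrix.specialUnitaryGroup (Fin 3) ℂ) => fun e => suConj 3 (U e)) (sliceHaar S) (sliceHaar S) ∧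
    MeasurePreserving (fun g : TorusSite 3 S → (Matrix.specialUnitaryGroup (Fin 3) ℂ) => fun x => suConj 3 (g x))
      (Measure.pi fun _ => haarProbability (Matrix.specialUnitaryGroup (Fin 3) ℂ)) (Measure.pi fun _ => haarProbability (Matrix.specialUnitaryGroup (Fin 3) ℂ)) := by
  intro Nf S _ β
  exact ⟨StubSliceDataSuConj.gaugeSliceKernel_suConj β, StubSliceDataSuConj.gaugeTransform_suConj,
    StubSliceDataSuConj.fockGaugeAct_suConj, StubSliceDataSuConj.measurePreserving_sliceHaar_suConj,
    StubSliceDataSuConj.measurePreserving_pi_suConj (TorusSite 3 S) 3⟩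

end Summit.QuantumFields.QCD.Cruxes.StableActionBridge.TwistedTraceTransfer

end
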